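import Summits.QuantumFields.BalabanUV.T4Continuum.Support.NE7OneStepOfRoutePi
import Summits.QuantumFields.BalabanUV.T4Continuum.Support.NE7SegmentPlaquetteRadius
import Summits.QuantumFields.BalabanUV.T4Continuum.Support.NE3ResidualSliceRep
import Summits.QuantumFields.BalabanUV.T4Continuum.Support.NE3EnergyHessBilin
import Summits.QuantumFields.BalabanUV.T4Continuum.Support.NE7ExactCurrent
import Summits.QuantumFields.BalabanUV.T4Continuum.Support.NE3CoarseInterpolant
import Summits.QuantumFields.BalabanUV.T4Continuum.Support.NE3TangentFlatStructure
import Literature.MathematicalPhysics.QuantumFieldTheory.Balaban1983to89.B5Hk163Torus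
import Literature.MathematicalPhysics.QuantumFieldTheory.Balaban1983to89.B6LowerBound2153Torus
import HarnessLib

/-!
# NE7FlatLiftBookkeeping — two bookkeeping pieces for the END at the trivial flat datum: (i) bricks 2–3's flat Landau lift `R_H B` is
# `(n·P)`-PERIODIC; (ii) F38's pointwise bootstrap with the slice solver letter asked on ALL complex tangent directions of the slice (no skewness of
# the normal part needed)

Cell `pub-balaban`, rung (B)+1 sub-cell t4, lineage `b2b-balaban-t4-ne7-p1`, generation 70 (CRUX PROVER NE7 #1); memo
`t4/b2b-balaban-t4-ne7-p1-g70/HUNT-H14-APE-FLAT-SKELETON.md` §5.  File F44 (over row NE3's `NE3TangentFlatStructure.framePot_add_period ∕ dPot_add_period`,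
`NE3CoarseInterpolant.interp_add_period`, lit-balaban's `B6LowerBound2153Torus.toT_add ∕ toT_period`, and the letters of F38 `NE7ApeFlatSkeleton` §2).
WHY.  The END at the trivial flat datum (successor's file: F38's bundle with LIFT♭ := `R_H B` — exact by F36, (R7♭) by F37, (R⊥♭) by F40b — (TT) by F41,
ĝ by F43, criticality by F39) needs two facts F38 §2 asks of the normal part that are not letters of Bałaban's: PERIODICITY of `R_H B` (§1 here) and
SKEWNESS (lit-balaban's reality of `H_k`'s kernel — not a tree theorem).  §2 removes the second: skewness of `A_N` entered F38 §2 only through the slice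
solver letter's antecedent `IsSkewDir X`; the linear solver bound ((1.115) TYPE) is a statement about complex fields, so the letter is re-asked on all
periodic tangent `X ∈ S` and `A_N` need not be skew.
WHAT ([folklore]; 0 def, 0 sorry).  §1 `pullback_add_period`, **`hkLift_periodic`** (`IsPeriodicDir (R_H B) (n·P)`, `n = L^{j+1}`, every `B`).  §2a
`norm_hol_vary_flat_sub_one_le_of_curl` (F38 §1's Taylor bound with the curl bound as a hypothesis).  §2 **`smallField_vary_of_flatLetters'`** — F38's
`smallField_vary_of_flatLetters` VERBATIM except: no `IsSkewDir A_N`, and `hG` quantified over all periodic tangent `X ∈ S`.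
HONEST FRAMING (page 1): bookkeeping; nothing of Bałaban's asserted; NOT (APE), NOT ONE-STEP, NOT NE7; spine 0∕9; finite T⁴ rung (B)+1 — NOT infinite volume,
NOT mass gap, NOT Clay.  Continuum YM on T⁴ ⇐ BetaPertH ∧ nine spine estimates (0/9 proved); BetaPertH ⇐ (D1) ∧ (D4) ∧ CAP+tail; G-an2-4 gates asym, D1 and
NE2/3/4.
-/

set_option autoImplicit false

open scoped BigOperators Matrix Matrix.Norms.L2Operator
open NormedSpace Finset Set

namespace Summit.QuantumFields.BalabanUV.T4Continuum.NE7FlatLiftBookkeeping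

open Literature.MathematicalPhysics.QuantumFieldTheory.Balaban1983to89
open B7Prop1Explicit B7Prop2Explicit MatrixLog UnitaryModel
open T4AveragingDeficitWall (IsUnitaryCfg IsSkewDir SmallField vary curlAt dirL1 vary_zero)
open T4AveragingDeficitWallBoundary (IsPeriodicCfg periodBox)
open AveragingDeficitPeriodicCounting (IsPeriodicDir)
open AveragingDeficitMultiLevelPrep (LevelSmall)
open MinimalActionLevels (perWin)
open NE3HessForm (hess dAction)
open NE3HessBounds (bondSqAt)
open NE3TangentCovariantTower (dirIter)
open NE3ResidualSliceRep (dirIter_sub)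
open NE3EnergyHessBilin (hess_add_left curlAt_add)
open NE7SegmentPlaquetteRadius (norm_hol_taylor_le bondSqAt_le_of_sup)
open NE7ExactCurrent (dAction_add)
open B5Prop11Plancherel (Tor fine)
open B5Hk163Torus (HkOp)
open B6Lemma24Torus (IsPeriod)
open B6LowerBound2153Torus (toT toT_add toT_period)
open SmoothRefineInterp (interp)
open NE3TangentNoGoWords (dPot)
open NE3TangentFlatStructure (framePot framePot_add_period dPot_add_period)

noncomputable section

variable {d : ℕ} {n : Type*} [Fintype n] [DecidableEq n]

/-! ## §1 The flat Landau lift of bricks 2–3 is periodic -/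

omit [Fintype n] [DecidableEq n] in
/-- An entrywise pull-back through `toT` of the fine torus `(n·P,…,n·P)` is `(n·P)`-periodic. [folklore] -/
theorem pullback_add_period (nn P : ℕ) [NeZero nn] [NeZero P] (h : n → n → (Tor (fine nn (fun _ : Fin d => P)) × Fin d → ℂ)) (x : Site d) (τ κ : Fin d) :
    (fun (y : Site d) (μ : Fin d) => Matrix.of fun i i' : n => h i i' (toT (fine nn (fun _ : Fin d => P)) y, μ)) (x + ((nn * P : ℕ) : ℤ) • e τ) κ
      = (fun (y : Site d) (μ : Fin d) => Matrix.of fun i i' : n => h i i' (toT (fine nn (fun _ : Fin d => P)) y, μ)) x κ := by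
  have hv : IsPeriod (fine nn (fun _ : Fin d => P)) (((nn * P : ℕ) : ℤ) • e τ) := by
    intro i
    simp only [Pi.smul_apply, smul_eq_mul, e_apply, fine]
    by_cases hi : i = τ
    · subst hi; simp
    · simp [hi]
  simp only [toT_add, toT_period _ hv, add_zero]

/-- **THE FLAT LANDAU LIFT `R_H B = A_H + dPot (interp n univ (framePot L (j+1) A_H))` IS `(n·P)`-PERIODIC** (`n = L^{j+1}`, `A_H` the entrywise
pull-back of `H_k B`): the pull-back is periodic by construction, row NE3's frame potential of a periodic field is `P`-periodic
(`framePot_add_period`), its interpolant is `(n·P)`-periodic (`NE3CoarseInterpolant.interp_add_period`) and so is its coboundary. [folklore] -/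
theorem hkLift_periodic {L : ℕ} (hL : 1 ≤ L) (j : ℕ) (P : ℕ) [NeZero P] [NeZero (L ^ (j + 1))] (B : Tor (fun _ : Fin d => P) × Fin d → Matrix n n ℂ) :
    IsPeriodicDir
      ((fun (x : Site d) (κ : Fin d) => Matrix.of fun i i' : n =>
          (HkOp (L ^ (j + 1)) (fun _ : Fin d => P) *ᵥ fun p : Tor (fun _ : Fin d => P) × Fin d => B p i i')
            (toT (fine (L ^ (j + 1)) (fun _ : Fin d => P)) x, κ))
        + dPot (interp (L ^ (j + 1)) Finset.univ (framePot L (j + 1)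
            (fun (x : Site d) (κ : Fin d) => Matrix.of fun i i' : n =>
              (HkOp (L ^ (j + 1)) (fun _ : Fin d => P) *ᵥ fun p : Tor (fun _ : Fin d => P) × Fin d => B p i i')
                (toT (fine (L ^ (j + 1)) (fun _ : Fin d => P)) x, κ)))))
      ((L ^ (j + 1) * P : ℕ) : ℤ) := by
  intro x τ κ
  have hM1 : 1 ≤ L ^ (j + 1) := Nat.one_le_pow _ _ hL
  set AH : Site d → Fin d → Matrix n n ℂ := fun (x : Site d) (κ : Fin d) => Matrix.of fun i i' : n =>
    (HkOp (L ^ (j + 1)) (fun _ : Fin d => P) *ᵥ fun p : Tor (fun _ : Fin d => P) × Fin d => B p i i')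
      (toT (fine (L ^ (j + 1)) (fun _ : Fin d => P)) x, κ) with hAH
  have hAHP : ∀ (y : Site d) (τ' μ : Fin d), AH (y + ((L ^ (j + 1) * P : ℕ) : ℤ) • e τ') μ = AH y μ := fun y τ' μ =>
    pullback_add_period (L ^ (j + 1)) P (fun i i' => HkOp (L ^ (j + 1)) (fun _ : Fin d => P) *ᵥ fun p => B p i i') y τ' μ
  -- the frame potential is `P`-periodic
  have hGP : ∀ (z : Site d) (τ' : Fin d), framePot L (j + 1) AH (z + (P : ℤ) • e τ') = framePot L (j + 1) AH z :=
    framePot_add_period L (j + 1) AH (P := (P : ℤ)) (fun y τ' μ => by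
      have h := hAHP y τ' μ; push_cast at h; exact h)
  -- its interpolant is `(n·P)`-periodic, hence so is the coboundary
  have hIP : ∀ (z : Site d) (τ' : Fin d), interp (L ^ (j + 1)) Finset.univ (framePot L (j + 1) AH) (z + ((L ^ (j + 1) * P : ℕ) : ℤ) • e τ')
      = interp (L ^ (j + 1)) Finset.univ (framePot L (j + 1) AH) z := fun z τ' =>
    NE3CoarseInterpolant.interp_add_period hM1 Finset.univ hGP z τ'
  simp only [Pi.add_apply]
  rw [hAHP x τ κ, dPot_add_period hIP x τ κ]

/-! ## §2a The flat Taylor bound with the curl bound as a hypothesis -/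

namespace NE7ApeFlatSkeletonLocal

/-- At a FLAT plaquette, a curl bound `‖(d_{F̃}A)(p′)‖ ≤ c` gives the plaquette bound `‖F̃e^{A}(∂p′) − 1‖ ≤ c + 28α₀²` (the Taylor bound of
`NE7SegmentPlaquetteRadius.norm_hol_taylor_le`; F38 §1's form with the curl bound as a hypothesis). [folklore] -/
theorem norm_hol_vary_flat_sub_one_le_of_curl [Nonempty n] {V : Site d → Fin d → (Matrix n n ℂ)ˣ} (hV : IsUnitaryCfg V) (hV0 : SmallField V 0)
    {X : Site d → Fin d → Matrix n n ℂ} (hX : IsSkewDir X) {α : ℝ} (hXα : ∀ y κ, ‖X y κ‖ ≤ α) (z : Site d) {μ ν : Fin d} (hμν : μ ≠ ν)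
    {c : ℝ} (hc : ‖curlAt V X z μ ν‖ ≤ c) :
    ‖((hol (vary V X 1) z (plaqWord μ ν) : (Matrix n n ℂ)ˣ) : Matrix n n ℂ) - 1‖ ≤ c + 28 * α ^ 2 := by
  have h1 : ((hol V z (plaqWord μ ν) : (Matrix n n ℂ)ˣ) : Matrix n n ℂ) = 1 := by
    have h := hV0 z μ ν hμν
    have : ‖((hol V z (plaqWord μ ν) : (Matrix n n ℂ)ˣ) : Matrix n n ℂ) - 1‖ = 0 := le_antisymm h (norm_nonneg _)
    exact sub_eq_zero.mp (norm_eq_zero.mp this)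
  have hT := norm_hol_taylor_le hV hX z μ ν 0 1
  rw [vary_zero, h1] at hT
  simp only [sub_zero, one_smul, mul_one, one_pow] at hT
  have hb := bondSqAt_le_of_sup hXα z μ ν
  have htri : ‖((hol (vary V X 1) z (plaqWord μ ν) : (Matrix n n ℂ)ˣ) : Matrix n n ℂ) - 1‖
      ≤ ‖((hol (vary V X 1) z (plaqWord μ ν) : (Matrix n n ℂ)ˣ) : Matrix n n ℂ) - 1 - curlAt V X z μ ν‖ + ‖curlAt V X z μ ν‖ := by
    have := norm_add_le (((hol (vary V X 1) z (plaqWord μ ν) : (Matrix n n ℂ)ˣ) : Matrix n n ℂ) - 1 - curlAt V X z μ ν) (curlAt V X z μ ν)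
    simpa using this
  linarith

end NE7ApeFlatSkeletonLocal

/-! ## §2 The pointwise bootstrap with a solver letter on ALL (complex) tangent directions of the slice -/

/-- **F38's POINTWISE BOOTSTRAP WITHOUT SKEWNESS OF THE NORMAL PART.**  Identical to `NE7ApeFlatSkeleton.smallField_vary_of_flatLetters` except
that the slice solver letter `hG` is asked on every (not necessarily skew) periodic tangent `X ∈ S` and, accordingly, no skewness of `A_N` is needed
— the linear solver bound ((1.115) TYPE) is a statement about complex fields; this is the form the trivial-datum lift `R_H B` (whose skewness on skew data
is lit-balaban's reality of `H_k`'s kernel, not yet a tree theorem) plugs into. [folklore] -/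
theorem smallField_vary_of_flatLetters' [Nonempty n] {L : ℕ} (hL : 1 ≤ L) (k : ℕ) {P : ℕ}
    {Ft : Site d → Fin d → (Matrix n n ℂ)ˣ} (hFt : IsUnitaryCfg Ft) (hFt0 : SmallField Ft 0)
    {x : ℝ} (hx : 0 ≤ x) (hs : LevelSmall d L k x) (hFtx : SmallField Ft x)
    {A : Site d → Fin d → Matrix n n ℂ} (hA : IsSkewDir A) (hAP : IsPeriodicDir A (P : ℤ)) {α₀ : ℝ} (hAα : ∀ y μ, ‖A y μ‖ ≤ α₀)
    {AN : Site d → Fin d → Matrix n n ℂ} (hNP : IsPeriodicDir AN (P : ℤ))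
    (hNexact : dirIter L (k + 1) Ft AN = dirIter L (k + 1) Ft A)
    {cN : ℝ} (hN7 : ∀ z μ ν, μ ≠ ν → ‖curlAt Ft AN z μ ν‖ ≤ cN)
    (hNorth : ∀ Y : Site d → Fin d → Matrix n n ℂ, IsSkewDir Y → IsPeriodicDir Y (P : ℤ) → dirIter L (k + 1) Ft Y = 0 →
      hess Ft AN Y (perWin d P) = 0)
    (S : Set (Site d → Fin d → Matrix n n ℂ)) (hTS : (fun y μ => A y μ - AN y μ) ∈ S) {KG : ℝ}
    (hG : ∀ X ∈ S, IsPeriodicDir X (P : ℤ) → dirIter L (k + 1) Ft X = 0 → ∀ g : ℝ, 0 ≤ g →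
      (∀ Y : Site d → Fin d → Matrix n n ℂ, IsSkewDir Y → IsPeriodicDir Y (P : ℤ) → dirIter L (k + 1) Ft Y = 0 →
        |hess Ft X Y (perWin d P)| ≤ g * dirL1 Y (periodBox (d := d) P)) →
      ∀ z μ ν, μ ≠ ν → ‖curlAt Ft X z μ ν‖ ≤ KG * g)
    {ρ : ℝ} (hρ : 0 ≤ ρ)
    (hEXP : ∀ Y : Site d → Fin d → Matrix n n ℂ, IsSkewDir Y → IsPeriodicDir Y (P : ℤ) →
      |dAction (vary Ft A 1) Y (perWin d P) - hess Ft A Y (perWin d P)| ≤ ρ * dirL1 Y (periodBox (d := d) P))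
    (hcrit : ∀ Y' : Site d → Fin d → Matrix n n ℂ, IsSkewDir Y' → IsPeriodicDir Y' (P : ℤ) → dirIter L (k + 1) (vary Ft A 1) Y' = 0 →
      dAction (vary Ft A 1) Y' (perWin d P) = 0)
    {τ : ℝ} (hτ : 0 ≤ τ)
    (hTT : ∀ Y : Site d → Fin d → Matrix n n ℂ, IsSkewDir Y → IsPeriodicDir Y (P : ℤ) → dirIter L (k + 1) Ft Y = 0 →
      ∃ Y' : Site d → Fin d → Matrix n n ℂ, IsSkewDir Y' ∧ IsPeriodicDir Y' (P : ℤ) ∧ dirIter L (k + 1) (vary Ft A 1) Y' = 0 ∧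
        |dAction (vary Ft A 1) (fun y μ => Y' y μ - Y y μ) (perWin d P)| ≤ τ * dirL1 Y (periodBox (d := d) P)) :
    SmallField (vary Ft A 1) (KG * (τ + ρ) + cN + 28 * α₀ ^ 2) := by
  set X : Site d → Fin d → Matrix n n ℂ := fun y μ => A y μ - AN y μ with hXdef
  have hXP : IsPeriodicDir X (P : ℤ) := fun y i μ => by simp only [hXdef, hAP y i μ, hNP y i μ]
  have hXT : dirIter L (k + 1) Ft X = 0 := by
    rw [hXdef, dirIter_sub hL k hFt hx hs hFtx A AN, hNexact]
    funext z κ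
    simp
  have hsrc : ∀ Y : Site d → Fin d → Matrix n n ℂ, IsSkewDir Y → IsPeriodicDir Y (P : ℤ) → dirIter L (k + 1) Ft Y = 0 →
      |hess Ft X Y (perWin d P)| ≤ (τ + ρ) * dirL1 Y (periodBox (d := d) P) := by
    intro Y hY hYP hYT
    have hsplitA : A = X + AN := by funext y μ; simp [hXdef]
    have hhess : hess Ft X Y (perWin d P) = hess Ft A Y (perWin d P) := by
      have h := hess_add_left Ft (perWin d P) X AN Y
      rw [← hsplitA, hNorth Y hY hYP hYT, add_zero] at h
      exact h.symm
    obtain ⟨Y', hY's, hY'P, hY'T, hY'd⟩ := hTT Y hY hYP hYT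
    have hc := hcrit Y' hY's hY'P hY'T
    have hdec : dAction (vary Ft A 1) Y (perWin d P)
        = dAction (vary Ft A 1) Y' (perWin d P) - dAction (vary Ft A 1) (fun y μ => Y' y μ - Y y μ) (perWin d P) := by
      have hYsum : Y' = Y + fun y μ => Y' y μ - Y y μ := by funext y μ; simp
      have h := dAction_add (vary Ft A 1) Y (fun y μ => Y' y μ - Y y μ) (perWin d P)
      rw [← hYsum] at h
      linarith
    have hdA : |dAction (vary Ft A 1) Y (perWin d P)| ≤ τ * dirL1 Y (periodBox (d := d) P) := by
      rw [hdec, hc, zero_sub, abs_neg]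
      exact hY'd
    have hE := hEXP Y hY hYP
    have htri : |hess Ft A Y (perWin d P)| ≤ |dAction (vary Ft A 1) Y (perWin d P)|
        + |dAction (vary Ft A 1) Y (perWin d P) - hess Ft A Y (perWin d P)| := by
      have := abs_sub_abs_le_abs_sub (hess Ft A Y (perWin d P)) (dAction (vary Ft A 1) Y (perWin d P))
      rw [abs_sub_comm] at this
      linarith
    rw [hhess]
    calc |hess Ft A Y (perWin d P)| ≤ τ * dirL1 Y (periodBox (d := d) P) + ρ * dirL1 Y (periodBox (d := d) P) := by linarith
      _ = (τ + ρ) * dirL1 Y (periodBox (d := d) P) := by ring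
  have hcurlX : ∀ z μ ν, μ ≠ ν → ‖curlAt Ft X z μ ν‖ ≤ KG * (τ + ρ) := hG X hTS hXP hXT (τ + ρ) (add_nonneg hτ hρ) hsrc
  have hcurlA : ∀ z μ ν, μ ≠ ν → ‖curlAt Ft A z μ ν‖ ≤ KG * (τ + ρ) + cN := by
    intro z μ ν hμν
    have hsplit : A = X + AN := by funext y κ; simp [hXdef]
    rw [hsplit, curlAt_add]
    exact (norm_add_le _ _).trans (add_le_add (hcurlX z μ ν hμν) (hN7 z μ ν hμν))
  intro z μ ν hμν
  exact NE7ApeFlatSkeletonLocal.norm_hol_vary_flat_sub_one_le_of_curl hFt hFt0 hA hAα z hμν (hcurlA z μ ν hμν)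

end

end Summit.QuantumFields.BalabanUV.T4Continuum.NE7FlatLiftBookkeeping
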